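import Summits.CriticalPhenomena.SAWScalingLimit.Theorems.SAWCompassLatticeSurfaceUniversalityLipPlusIsUnifWalks
import Summits.CriticalPhenomena.SAWScalingLimit.Theorems.SAWCompassLatticeSurfaceUniversalityDefs
import Summits.CriticalPhenomena.SAWScalingLimit.Theorems.SAWDevelopingMapHexTransferPortTransfer

/-!
# The plus dictionary, II: the critical plus law is the uniform point of the face-weight family
# (stub `stub_lipPlusIsUnif : LipPlusIsUnif`)

Line `registered` (`Lines/birth.lean`, reshaped by the lead) for the crux `SurfaceUniversality`
(stmt-CriticalPhenomena-6964, route `SAWCompassLattice`), stub `stub_lipPlusIsUnif`: for every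
domain `Ω` and all families of ports `a δ, b δ`, the critical plus-lattice chordal law `plusLaw`
(self-avoiding port–centre–…–port paths of the plus lattice through centres of faces of
`meshFaces (π/2) Ω δ`, half-edge fugacity `√x_c`, drawn through ports AND centres) and the uniform
point `unifLaw = fwLaw x_c x_c x_c 0 0` of Glazman–Manolescu's face-weight family (a visited face
costs `x_c` whatever its arc, a face visited twice costs `0`) drawn by `YBWalk.curve` (through ports
only) merge on bounded Lipschitz test functions as `δ → 0⁺`; in fact
`‖∫ f d(plusLaw) − ∫ f∘curve d(unifLaw)‖ ≤ L·|δ|` (`norm_integral_plus_sub_unif_le`).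

Proof (the plus dictionary; part I `…LipPlusIsUnifWalks.lean` is the combinatorics):
* `fwWeight_eq_pow_of_nodup` / `fwWeight_eq_zero_of_not_nodup`: at `(u, u, u, w₁, w₂)` a Yang–Baxter
  walk whose arcs lie in pairwise distinct faces weighs `u^{#arcs}` (each visited face carries one
  non-degenerate arc), and at `w₁ = w₂ = 0` every other walk weighs `0`;
* `map_plusToYB`: hence pushing the plus path measure `ρ₀ = Σ_p (√x_c)^{#darts} δ_p` forward along
  `plusToYB` (port sequence; injective, onto the walks visiting no face twice, `#darts = 2 #arcs`)
  gives `fwMeasure x_c x_c x_c 0 0`; so `unifLaw = ρ.map plusToYB` and `plusLaw = ρ.map (drawing)`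
  for the normalised `ρ`, which is `0` or a probability measure (`plusRho_zero_or_prob`);
* `dist_plusCurve_curve_le`: the two drawings of one plus path are at distance `≤ |δ|` (the centre
  of a unit square is at distance `1/2` from its side midpoints; repeating vertices does not change
  a curve class, `PortTransfer.mk_polyline_stay`);
* `PortTransfer.norm_integral_sub_integral_le` and a squeeze.

Glazman–Manolescu, arXiv:1708.00395, §1 and Fig. 1; tagged [folklore] (bookkeeping).
-/

noncomputable section

namespace Summit.CriticalPhenomena.SAWScalingLimit.Theorems.SurfaceUniversality

open MeasureTheory Filter Topology Set
open scoped NNReal ENNReal BoundedContinuousFunction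
open Literature.Probability.RandomPlanarGeometry
open Literature.Probability.RandomPlanarGeometry.SAW
open Literature.Probability.RandomPlanarGeometry.SAW.YangBaxter
open Literature.Probability.LatticeModels (polyline)
open Summit.CriticalPhenomena.SAWScalingLimit.Cruxes.HexTransfer.Sketch (PortTransfer.stay
  PortTransfer.stay_cons_some PortTransfer.stay_cons_none PortTransfer.map_stay
  PortTransfer.mk_polyline_stay PortTransfer.dist_mk_polyline_le
  PortTransfer.map_filterMap_eq_reduceOption PortTransfer.norm_integral_sub_integral_le
  PortTransfer.norm_planeMidpoint_side_sub)

/-! ### Face weights of walks visiting each face at most once -/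

section FaceWeights

variable {D : Set Face} {a z : MidEdge}

/-- **In a walk whose arcs lie in pairwise distinct faces, a visited face carries exactly one,
non-degenerate, arc.** [folklore] -/
theorem kindsIn_eq_singleton_of_nodup (γ : YBWalk D a z) (hγ : (γ.arcs.map arcFace).Nodup)
    {f : Face} (hf : f ∈ γ.facesVisited) : ∃ κ, κ ≠ ArcKind.degen ∧ γ.kindsIn f = [κ] := by
  obtain ⟨q, hq, hqf⟩ := γ.mem_facesVisited_iff.1 hf
  obtain ⟨l₁, l₂, hl⟩ := List.append_of_mem hq
  obtain ⟨s, t, hst, -, -, hk⟩ := exists_sides_of_arcFace hqf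
  refine ⟨arcKind s t, by cases s <;> cases t <;> simp [arcKind] at hst ⊢, ?_⟩
  have hγ' : ((l₁ ++ q :: l₂).map arcFace).Nodup := hl ▸ hγ
  rw [List.map_append, List.map_cons, List.nodup_middle, List.nodup_cons, List.mem_append,
    not_or, hqf] at hγ'
  have h₁ : l₁.filterMap (kindF f) = [] := List.filterMap_eq_nil_iff.2 fun q' hq' =>
    kindF_of_ne fun h => hγ'.1.1 (List.mem_map.2 ⟨q', hq', h⟩)
  have h₂ : l₂.filterMap (kindF f) = [] := List.filterMap_eq_nil_iff.2 fun q' hq' =>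
    kindF_of_ne fun h => hγ'.1.2 (List.mem_map.2 ⟨q', hq', h⟩)
  rw [YBWalk.kindsIn_eq, hl, List.filterMap_append, h₁, List.nil_append,
    List.filterMap_cons_some (show kindF f q = some (arcKind s t) by rw [kindF, if_pos hqf, hk]), h₂]

/-- A walk whose arcs lie in pairwise distinct faces visits as many faces as it has arcs.
[folklore] -/
theorem card_facesVisited_eq_of_nodup (γ : YBWalk D a z) (hγ : (γ.arcs.map arcFace).Nodup) :
    γ.facesVisited.card = γ.arcs.length := by
  have hmap : (γ.arcs.filterMap arcFace).map some = γ.arcs.map arcFace := by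
    rw [List.map_filterMap_some_eq_filter_map_isSome, List.filter_eq_self]
    intro o ho
    obtain ⟨q, hq, rfl⟩ := List.mem_map.1 ho
    obtain ⟨f, -, hf⟩ := γ.arc_mem q hq
    rw [hf, Option.isSome_some]
  have hnd : (γ.arcs.filterMap arcFace).Nodup := List.Nodup.of_map some (hmap ▸ hγ)
  rw [YBWalk.facesVisited_eq, List.toFinset_card_of_nodup hnd, ← List.length_map (f := some), hmap,
    List.length_map]

/-- **At `u₁ = u₂ = v = u`, a walk whose arcs lie in pairwise distinct faces weighs `u^{#arcs}`.**
[folklore] -/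
theorem fwWeight_eq_pow_of_nodup (u w₁ w₂ : ℝ) (γ : YBWalk D a z) (hγ : (γ.arcs.map arcFace).Nodup) :
    fwWeight u u u w₁ w₂ γ = u ^ γ.arcs.length := by
  have h : ∀ f ∈ γ.facesVisited, fwLocalWeight u u u w₁ w₂ (γ.kindsIn f) = u := fun f hf => by
    obtain ⟨κ, hκ, e⟩ := kindsIn_eq_singleton_of_nodup γ hγ hf
    rw [e, fwLocalWeight_singleton u w₁ w₂ hκ]
  rw [fwWeight, Finset.prod_congr rfl h, Finset.prod_const, card_facesVisited_eq_of_nodup γ hγ]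

/-- **At `w₁ = w₂ = 0`, a walk two of whose arcs lie in one face weighs `0`.** [folklore] -/
theorem fwWeight_eq_zero_of_not_nodup (u₁ u₂ v : ℝ) (γ : YBWalk D a z)
    (hγ : ¬(γ.arcs.map arcFace).Nodup) : fwWeight u₁ u₂ v 0 0 γ = 0 := by
  obtain ⟨x, hx⟩ := List.exists_duplicate_iff_not_nodup.2 hγ
  rw [List.duplicate_iff_sublist, List.sublist_map_iff] at hx
  obtain ⟨l', hl', hx⟩ := hx
  obtain ⟨q₁, l₁, rfl, hq₁, hx₁⟩ := List.map_eq_cons_iff.1 hx.symm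
  obtain ⟨q₂, l₂, rfl, hq₂, hx₂⟩ := List.map_eq_cons_iff.1 hx₁
  obtain rfl : l₂ = [] := List.map_eq_nil_iff.1 hx₂
  obtain ⟨f, -, hf₁⟩ := γ.arc_mem q₁ (hl'.subset (by simp))
  have hf₂ : arcFace q₂ = some f := by rw [hq₂, ← hq₁, hf₁]
  obtain ⟨s₁, t₁, -, -, -, hk₁⟩ := exists_sides_of_arcFace hf₁
  obtain ⟨s₂, t₂, -, -, -, hk₂⟩ := exists_sides_of_arcFace hf₂
  have hsub : [arcKind s₁ t₁, arcKind s₂ t₂].Sublist (γ.kindsIn f) := by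
    have h := hl'.filterMap (kindF f)
    rwa [List.filterMap_cons_some (show kindF f q₁ = some (arcKind s₁ t₁) by rw [kindF, if_pos hf₁, hk₁]),
      List.filterMap_cons_some (show kindF f q₂ = some (arcKind s₂ t₂) by rw [kindF, if_pos hf₂, hk₂]),
      List.filterMap_nil, ← YBWalk.kindsIn_eq] at h
  have hlen := hsub.length_le
  refine Finset.prod_eq_zero (γ.mem_facesVisited_iff.2 ⟨q₁, hl'.subset (by simp), hf₁⟩) ?_
  rcases hk : γ.kindsIn f with _ | ⟨κ₁, _ | ⟨κ₂, rest⟩⟩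
  · rw [hk] at hlen; simp at hlen
  · rw [hk] at hlen; simp at hlen
  · exact fwLocalWeight_two_of_zero u₁ u₂ v κ₁ κ₂ rest

end FaceWeights

/-! ### The plus path measure; the plus law and the uniform law as its push-forwards -/

/-- **The critical plus path measure** `ρ₀ = Σ_p (√x_c)^{#darts of p} δ_p` on the self-avoiding plus
paths of `Ω_δ` from port `a` to port `b`. [folklore] -/
def plusRho0 (Ω : Set ℂ) (δ : ℝ) (a b : MidEdge) : Measure (PPath (meshFaces rightAngles Ω δ) a b) :=
  Measure.sum fun p =>
    ENNReal.ofReal (PortGadget.walkWeight (plusFugacity (Real.sqrt SAW.criticalFugacity)) p.1) •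
      Measure.dirac p

/-- The normalised plus path measure (junk `0` if the mass is `0` or `∞`). [folklore] -/
def plusRho (Ω : Set ℂ) (δ : ℝ) (a b : MidEdge) : Measure (PPath (meshFaces rightAngles Ω δ) a b) :=
  (plusRho0 Ω δ a b Set.univ)⁻¹ • plusRho0 Ω δ a b

/-- **The plus path drawn at mesh `δ'`** (polyline through the rescaled ports AND centres), modulo
reparametrisation. [folklore] -/
def plusCurve {Δ : Set Face} {a b : MidEdge} (δ' : ℝ) (p : PPath Δ a b) : CurveClass ℂ :=
  CurveClass.mk ⟨p.1.toCurve fun v => (δ' : ℂ) * PortGadget.embed plusPos v⟩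

section PushForward

variable (Ω : Set ℂ) (δ : ℝ) (a b : MidEdge)

/-- The plus path measure on curves is `ρ₀` pushed forward along the drawing. [folklore] -/
theorem plusPathMeasure_eq_map :
    PortGadget.pathMeasure plusLattice (plusFugacity (Real.sqrt SAW.criticalFugacity))
      (PortGadget.embed plusPos) (PortGadget.inFaces (meshFaces rightAngles Ω δ)) δ
      (Sum.inl a) (Sum.inl b) = (plusRho0 Ω δ a b).map (plusCurve δ) := by
  rw [plusRho0, Measure.map_sum (measurable_ppath _).aemeasurable]
  unfold PortGadget.pathMeasure
  congr 1
  funext p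
  rw [Measure.map_smul, Measure.map_dirac' (measurable_ppath _)]
  rfl

/-- The total masses agree. [folklore] -/
theorem plusPathMeasure_univ :
    PortGadget.pathMeasure plusLattice (plusFugacity (Real.sqrt SAW.criticalFugacity))
      (PortGadget.embed plusPos) (PortGadget.inFaces (meshFaces rightAngles Ω δ)) δ
      (Sum.inl a) (Sum.inl b) Set.univ = plusRho0 Ω δ a b Set.univ := by
  rw [plusPathMeasure_eq_map, Measure.map_apply (measurable_ppath _) MeasurableSet.univ,
    Set.preimage_univ]

/-- **The plus law is the push-forward of the normalised plus path measure along the drawing.**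
[folklore] -/
theorem plusLaw_eq_map : plusLaw Ω δ a b = (plusRho Ω δ a b).map (plusCurve δ) := by
  rw [plusLaw, PortGadget.pathLaw, plusRho, Measure.map_smul, ← plusPathMeasure_eq_map,
    plusPathMeasure_univ]

/-- The normalised plus path measure is `0` (junk) or a probability measure. [folklore] -/
theorem plusRho_zero_or_prob :
    plusRho Ω δ a b = 0 ∨ IsProbabilityMeasure (plusRho Ω δ a b) := by
  unfold plusRho
  by_cases h0 : plusRho0 Ω δ a b Set.univ = 0
  · left
    rw [Measure.measure_univ_eq_zero.1 h0, smul_zero]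
  by_cases htop : plusRho0 Ω δ a b Set.univ = ⊤
  · left
    rw [htop, ENNReal.inv_top, zero_smul]
  · right
    exact ⟨by rw [Measure.smul_apply, smul_eq_mul, ENNReal.inv_mul_cancel h0 htop]⟩

/-- **A plus path weighs `x_c^{#arcs of its Yang–Baxter walk}`** (`(√x_c)^{2n}`; `x_c = 1/μ ≥ 0`, `μ`
being an infimum of nonnegative reals). [folklore] -/
theorem walkWeight_eq_pow {Δ : Set Face} (p : PPath Δ a b) :
    PortGadget.walkWeight (plusFugacity (Real.sqrt SAW.criticalFugacity)) p.1 =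
      SAW.criticalFugacity ^ (plusToYB p).arcs.length := by
  have hxc : 0 ≤ SAW.criticalFugacity :=
    inv_nonneg.2 (Real.iInf_nonneg fun _ => Real.rpow_nonneg (Nat.cast_nonneg _) _)
  rw [walkWeight_plusFugacity, length_eq_two_mul_length_arcs, pow_mul, Real.sq_sqrt hxc]

/-- **The plus dictionary as an identity of measures**: pushing `ρ₀` forward along `plusToYB`
gives the uniform face-weight measure `fwMeasure x_c x_c x_c 0 0` — over a walk visiting no face
twice the fibre is one plus path of the same weight `x_c^{#arcs}`, over any other walk the fibre is
empty and the uniform weight vanishes. [folklore] -/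
theorem map_plusToYB : (plusRho0 Ω δ a b).map plusToYB =
    fwMeasure SAW.criticalFugacity SAW.criticalFugacity SAW.criticalFugacity 0 0 Ω δ a b := by
  refine Measure.ext fun S _ => ?_
  rw [Measure.map_apply (measurable_ppath _) MeasurableSpace.measurableSet_top, plusRho0,
    Measure.sum_apply _ MeasurableSpace.measurableSet_top, fwMeasure,
    Measure.sum_apply _ MeasurableSpace.measurableSet_top]
  simp only [Measure.smul_apply, smul_eq_mul, Measure.dirac_apply' _ MeasurableSpace.measurableSet_top]
  rw [← (Equiv.sigmaFiberEquiv plusToYB).tsum_eq, ENNReal.tsum_sigma']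
  refine tsum_congr fun γ => ?_
  have hind : ∀ q : {p : PPath (meshFaces rightAngles Ω δ) a b // plusToYB p = γ},
      (plusToYB ⁻¹' S).indicator (1 : PPath (meshFaces rightAngles Ω δ) a b → ℝ≥0∞) q.1 =
        S.indicator 1 γ := by
    rintro ⟨q, hq⟩
    by_cases hS : γ ∈ S
    · rw [Set.indicator_of_mem hS, Set.indicator_of_mem (show q ∈ plusToYB ⁻¹' S by
        rw [Set.mem_preimage, hq]; exact hS)]
      rfl
    · rw [Set.indicator_of_notMem hS, Set.indicator_of_notMem (show q ∉ plusToYB ⁻¹' S by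
        rw [Set.mem_preimage, hq]; exact hS)]
  simp only [Equiv.sigmaFiberEquiv_apply, hind, ENNReal.tsum_mul_right]
  congr 1
  by_cases hγ : (γ.arcs.map arcFace).Nodup
  · obtain ⟨p₀, hp₀⟩ := exists_plusToYB_eq γ hγ
    rw [tsum_eq_single ⟨p₀, hp₀⟩ fun q hq =>
        absurd (Subtype.ext (plusToYB_injective (q.2.trans hp₀.symm))) hq,
      walkWeight_eq_pow, hp₀, fwWeight_eq_pow_of_nodup _ _ _ γ hγ]
  · haveI : IsEmpty {p : PPath (meshFaces rightAngles Ω δ) a b // plusToYB p = γ} :=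
      ⟨fun q => hγ (q.2 ▸ nodup_map_arcFace_plusToYB q.1)⟩
    rw [tsum_empty, fwWeight_eq_zero_of_not_nodup _ _ _ γ hγ, ENNReal.ofReal_zero]

/-- **The partition functions agree**: `Σ_γ fwWeight x_c x_c x_c 0 0 γ = Σ_p (√x_c)^{#darts}`.
[folklore] -/
theorem fwMeasure_univ_eq :
    fwMeasure SAW.criticalFugacity SAW.criticalFugacity SAW.criticalFugacity 0 0 Ω δ a b Set.univ =
      plusRho0 Ω δ a b Set.univ := by
  rw [← map_plusToYB, Measure.map_apply (measurable_ppath _) MeasurableSet.univ, Set.preimage_univ]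

/-- **The uniform law is the push-forward of the normalised plus path measure along `plusToYB`.**
[folklore] -/
theorem unifLaw_eq_map : unifLaw Ω δ a b = (plusRho Ω δ a b).map plusToYB := by
  rw [unifLaw, fwLaw, plusRho, Measure.map_smul, map_plusToYB, fwMeasure_univ_eq]

end PushForward

/-! ### The `O(δ)` drawing coupling: through ports and centres vs through ports only -/

/-- The centre of a face is within distance `1` (in fact `1/2`) of the midpoint of each of its
sides. [folklore] -/
theorem dist_embed_inr_planeMidpoint_le (f : Face) (sd : Side) :
    dist (PortGadget.embed plusPos (Sum.inr (f, ()))) (planeMidpoint rightAngles (f.side sd)) ≤ 1 := by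
  have h : ‖planeMidpoint rightAngles (f.side sd) - (planeCorner rightAngles f + (1 + Complex.I) / 2)‖ =
      1 / 2 := PortTransfer.norm_planeMidpoint_side_sub f sd
  rw [dist_comm, dist_eq_norm]
  change ‖planeMidpoint rightAngles (f.side sd) - (planeCorner rightAngles f + (1 + Complex.I) / 2)‖ ≤ 1
  rw [h]
  norm_num

/-- **The coupling, vertex by vertex.** Along an adjacency chain `u :: t` of the plus lattice, if
the "last port seen" `e` at `u` is `u` itself (when `u` is a port) or a side of the face of `u`
(when `u` is a centre), then every vertex of `t` is embedded within distance `1` of the midpoint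
of the last port seen before or at it. [folklore] -/
theorem plus_forall₂_support_stay (t : List PVert) : ∀ (e : MidEdge) (u : PVert),
    List.IsChain plusLattice.Adj (u :: t) → (∀ e', u = Sum.inl e' → e' = e) →
    (∀ f q, u = Sum.inr (f, q) → ∃ sd, f.side sd = e) →
    List.Forall₂ (fun v w => dist (PortGadget.embed plusPos v) w ≤ 1) t
      (PortTransfer.stay (planeMidpoint rightAngles e)
        (t.map fun v => (Sum.getLeft? v).map (planeMidpoint rightAngles))) := by
  induction t with
  | nil => intros; exact List.Forall₂.nil
  | cons v t ih =>
    intro e u hchain hinl hinr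
    obtain ⟨huv, ht⟩ := List.isChain_cons_cons.1 hchain
    rcases v with e' | ⟨f, ⟨⟩⟩
    · simp only [List.map_cons, Sum.getLeft?_inl, Option.map_some, PortTransfer.stay_cons_some]
      refine List.Forall₂.cons ?_ (ih e' (Sum.inl e') ht
        (fun e'' h => (Sum.inl_injective h).symm) (fun f q h => absurd h Sum.inl_ne_inr))
      simp [PortGadget.embed]
    · simp only [List.map_cons, Sum.getLeft?_inr, Option.map_none, PortTransfer.stay_cons_none]
      have hside : ∃ sd, f.side sd = e := by
        rcases u with e'' | ⟨f', q'⟩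
        · obtain rfl := hinl e'' rfl
          exact (plusLattice_adj_inl_inr _ _ _).1 huv
        · exact absurd huv (plusLattice_adj_inr_inr _ _ _ _)
      obtain ⟨sd, hsd⟩ := hside
      refine List.Forall₂.cons ?_ (ih e (Sum.inr (f, ())) ht
        (fun e'' h => absurd h Sum.inr_ne_inl) ?_)
      · rw [← hsd]
        exact dist_embed_inr_planeMidpoint_le f sd
      · rintro f' q' h
        cases h
        exact ⟨sd, hsd⟩

/-- **The `O(δ)` coupling.** A plus path of `Ω_δ` drawn at mesh `δ` (through ports and centres)
and the drawing at mesh `δ` of its Yang–Baxter walk (through the same ports) are at distance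
`≤ |δ|` in `CurveClass ℂ`: the polyline through the ports-with-repetitions is the Yang–Baxter
polyline up to reparametrisation, and each centre is within `δ/2` of the last port. [folklore] -/
theorem dist_plusCurve_curve_le {Ω : Set ℂ} {δ : ℝ} {a b : MidEdge}
    (p : PPath (meshFaces rightAngles Ω δ) a b) :
    dist (plusCurve δ p) ((plusToYB p).curve rightAngles δ) ≤ |δ| := by
  set m : MidEdge → ℂ := planeMidpoint rightAngles with hm
  set pt : MidEdge → ℂ := fun e => (δ : ℂ) * m e with hpt
  have hsupp : p.1.support = Sum.inl a :: p.1.support.tail := p.1.cons_tail_support.symm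
  set t : List PVert := p.1.support.tail with ht
  -- the Yang–Baxter curve is the polyline through the ports, repeated along the centres
  have hQ : (plusToYB p).curve rightAngles δ = CurveClass.mk
      ⟨polyline (pt a :: PortTransfer.stay (pt a) (t.map fun v => (Sum.getLeft? v).map pt))⟩ := by
    rw [PortTransfer.mk_polyline_stay, ← PortTransfer.map_filterMap_eq_reduceOption]
    unfold YBWalk.curve YBWalk.path YBWalk.points
    rw [plusToYB_mids, plusPorts, hsupp,
      List.filterMap_cons_some (show Sum.getLeft? (Sum.inl a : PVert) = some a from rfl), List.map_cons]
  rw [hQ]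
  unfold plusCurve SimpleGraph.Walk.toCurve
  rw [hsupp, List.map_cons]
  refine PortTransfer.dist_mk_polyline_le (abs_nonneg δ) (List.Forall₂.cons ?_ ?_)
  · simp [PortGadget.embed, hpt, hm]
  · have h := plus_forall₂_support_stay t a (Sum.inl a) (hsupp ▸ p.1.isChain_adj_support)
      (fun e' h => (Sum.inl_injective h).symm) (fun f q h => absurd h Sum.inl_ne_inr)
    have hstay : PortTransfer.stay (pt a) (t.map fun v => (Sum.getLeft? v).map pt) =
        (PortTransfer.stay (m a) (t.map fun v => (Sum.getLeft? v).map m)).map fun x => (δ : ℂ) * x := by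
      rw [PortTransfer.map_stay, List.map_map]
      congr 1
      refine List.map_congr_left fun v _ => ?_
      simp only [Function.comp_apply, Option.map_map, hpt]
      rfl
    rw [hstay, List.forall₂_map_left_iff, List.forall₂_map_right_iff]
    refine h.imp fun {v x} hvx => ?_
    rw [dist_eq_norm, ← mul_sub, norm_mul, Complex.norm_real, Real.norm_eq_abs, ← dist_eq_norm]
    exact mul_le_of_le_one_right (abs_nonneg δ) hvx

/-! ### Conclusion -/

/-- **The plus law and the uniform law differ by at most `L·|δ|` on a bounded `L`-Lipschitz test
function** (any domain, mesh and ports; both laws are push-forwards of ONE normalised plus path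
measure, `0` or a probability measure, along two drawings at distance `≤ |δ|`). [folklore] -/
theorem norm_integral_plus_sub_unif_le (Ω : Set ℂ) (δ : ℝ) (a b : MidEdge) (f : CurveClass ℂ →ᵇ ℝ)
    {L : ℝ≥0} (hf : LipschitzWith L f) :
    ‖(∫ x, f x ∂(plusLaw Ω δ a b)) - ∫ γ, f (γ.curve rightAngles δ) ∂(unifLaw Ω δ a b)‖ ≤ L * |δ| := by
  have h1 : ∫ x, f x ∂(plusLaw Ω δ a b) = ∫ p, f (plusCurve δ p) ∂(plusRho Ω δ a b) := by
    rw [plusLaw_eq_map, integral_map (measurable_ppath _).aemeasurable f.continuous.aestronglyMeasurable]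
  have h2 : ∫ γ, f (γ.curve rightAngles δ) ∂(unifLaw Ω δ a b) =
      ∫ p, f ((plusToYB p).curve rightAngles δ) ∂(plusRho Ω δ a b) := by
    rw [unifLaw_eq_map, integral_map (measurable_ppath _).aemeasurable]
    exact (YBWalk.measurable_of_top _).aestronglyMeasurable
  rw [h1, h2]
  have key := PortTransfer.norm_integral_sub_integral_le (ε := |δ|) (plusRho_zero_or_prob Ω δ a b)
    (measurable_ppath _).aemeasurable (measurable_ppath _).aemeasurable f hf
    (fun p => dist_plusCurve_curve_le p)
  rwa [abs_abs] at key

/-- **`LipPlusIsUnif` (the plus law IS the uniform point of the face-weight family, up to an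
`O(δ)` redraw)**: for every domain and all families of ports, the critical plus-lattice law and
the uniform face-weight law `unifLaw = fwLaw x_c x_c x_c 0 0` drawn by `YBWalk.curve` merge on
bounded Lipschitz test functions along `δ → 0⁺` (squeeze by `L·|δ| → 0`). [folklore] -/
theorem lipPlusIsUnif : LipPlusIsUnif := by
  intro Ω a b f L hf
  have hε : Tendsto (fun δ : ℝ => (L : ℝ) * |δ|) (𝓝[>] (0 : ℝ)) (𝓝 0) := by
    have h0 : Tendsto (fun δ : ℝ => |δ|) (𝓝[>] (0 : ℝ)) (𝓝 0) :=
      (continuous_abs.tendsto' (0 : ℝ) 0 abs_zero).mono_left nhdsWithin_le_nhds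
    simpa using (tendsto_const_nhds (x := (L : ℝ))).mul h0
  exact squeeze_zero_norm (fun δ => norm_integral_plus_sub_unif_le Ω δ (a δ) (b δ) f hf) hε

/-- Stub `stub_lipPlusIsUnif` of the line `registered` (`Lines/birth.lean`) for the crux
`SurfaceUniversality` (stmt-CriticalPhenomena-6964), under its registered name. [folklore] -/
theorem stub_lipPlusIsUnif : LipPlusIsUnif := lipPlusIsUnif

end Summit.CriticalPhenomena.SAWScalingLimit.Theorems.SurfaceUniversality

end
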